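import Literature.AlgebraicTopology.SingularHomology.TwoPieceKappaLinear
import Literature.AlgebraicTopology.SingularHomology.SphereLikeFibre
import HarnessLib

/-!
# Cup-product form of the splittings of `H*(U × C)` and `H*(U × P)` (circle- and sphere-like fibres)

A. Hatcher, *Algebraic Topology* (2002), §3.1 pp. 200–202 with §3.2 Thm. 3.16 (Künneth for
`Y = Sᵏ`, `H*(X × Sᵏ) ≅ H*(X) ⊗ H*(Sᵏ)`: "`H*(X × Y; R)` is a free `H*(X; R)`-module with basis the
cross products with a basis of `H*(Y; R)`") and D. Husemoller, *Fibre Bundles*, Ch. 17 §1 (the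
local form of Leray–Hirsch): the splitting maps of `CircleLikeProductCohomology`,
`SphereLikeProductCohomology`, `SphereLikeFibre` are `H*(U)`-LINEAR, hence of cup-product form:

* `extPlus_cupProduct` — `ext₊(c ⌣ c') = ext₊ c ⌣ pr^* c'`;
* `IsCircleLike.circleSigma_cupProduct` — `κ(ext₊(c ⌣ c')) = κ(ext₊ c) ⌣ pr₁^* c'`;
* `IsSphereLike.sigmaMap_cupProduct` — `σ(c ⌣ c') = σ(c) ⌣ pr₁^* c'`, so `σ(c) = σ(1) ⌣ pr₁^* c`
  (`sigmaMap_eq_sigmaMap_one_cup`), and `σ_U(1) = pr₂^* ω(1)` (`sigmaMap_one_eq_map_snd_omegaFibre`);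
* **`IsSphereLike.sphereMap_eq_cup`** — `sphereMap (y, c) = pr₁^* y + pr₂^* ω(1) ⌣ pr₁^* c`: for a
  sphere-like `P` and every `U`, `(y, c) ↦ pr₁^* y + pr₂^* ω ⌣ pr₁^* c : Hⁱ⁺²(U) × Hⁱ(U) → Hⁱ⁺²(U × P)`
  is bijective (`cupSplit_bijective`) — `H*(U × P)` is free over `H*(U)` on `1, ω`.

Everything is proved; no named facts.

## References

* A. Hatcher, *Algebraic Topology*, CUP 2002, §3.1 pp. 200–202, §3.2 Thm. 3.16. [HatcherAT2002]
* D. Husemoller, *Fibre Bundles*, GTM 20, Springer 1994, Ch. 17 §1 Thm. 1.1. [HusemollerFibreBundles1994]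
-/

noncomputable section

open CategoryTheory Set

universe u

namespace Literature.AlgebraicTopology.SingularHomology

variable {U U' : Type u} {Y : Type u} [TopologicalSpace U] [TopologicalSpace U'] [TopologicalSpace Y]
variable (R : Type u) [CommRing R]

/-! ### The extension `ext₊` is linear -/

namespace IsCircleLike

variable {Y₁ Y₂ Zp Zm : Set Y} (hY : IsCircleLike Y Y₁ Y₂ Zp Zm)
include hY

/-- **`ext₊ (c ⌣ c') = ext₊ c ⌣ pr^* c'`** (check on the two clopen pieces). [cite: HatcherAT2002, §3.1 p. 202] -/
theorem extPlus_cupProduct {i j n : ℕ} (h : i + j = n) (c : singularCohomology R R U i) (c' : singularCohomology R R U j) :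
    hY.extPlus R R n (cupProduct h c c') =
      cupProduct h (hY.extPlus R R i c) (singularCohomology.map R R (fstInter U Y₁ Y₂) j c') := by
  refine hY.eq_of_map_pieces_eq R R ?_ ?_
  · rw [hY.map_plus_extPlus R R, cupProduct_map, cupProduct_map, hY.map_plus_extPlus R R]
    congr 1
    rw [← ModuleCat.comp_apply, ← singularCohomology.map_comp]
    rfl
  · rw [hY.map_minus_extPlus R R, cupProduct_map, hY.map_minus_extPlus R R, map_zero, LinearMap.zero_apply]

/-- **The circle's second summand is linear: `κ(ext₊(c ⌣ c')) = κ(ext₊ c) ⌣ pr₁^* c'`.** [cite: HatcherAT2002, §3.1 pp. 200–202] -/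
theorem circleSigma_cupProduct {i j n : ℕ} (h : i + j = n) (c : singularCohomology R R U i) (c' : singularCohomology R R U j) :
    twoPieceKappa R R hY.isOpen_left hY.isOpen_right hY.union_eq n (hY.extPlus R R n (cupProduct h c c')) =
      cupProduct (show (i + 1) + j = n + 1 by omega)
        (twoPieceKappa R R hY.isOpen_left hY.isOpen_right hY.union_eq i (hY.extPlus R R i c))
        (singularCohomology.map R R (ContinuousMap.fst : C(U × Y, U)) j c') := by
  rw [hY.extPlus_cupProduct R h, ← twoPieceKappa_cupProduct R hY.isOpen_left hY.isOpen_right hY.union_eq h,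
    ← ModuleCat.comp_apply, ← singularCohomology.map_comp]
  rfl

/-- `circleMap (0, c ⌣ c') = circleMap (0, c) ⌣ pr₁^* c'`. [cite: HatcherAT2002, §3.1 pp. 200–202] -/
theorem circleMap_zero_cupProduct {i j n : ℕ} (h : i + j = n) (c : singularCohomology R R U i)
    (c' : singularCohomology R R U j) :
    hY.circleMap R R (U := U) n (0, cupProduct h c c') =
      cupProduct (show (i + 1) + j = n + 1 by omega) (hY.circleMap R R (U := U) i (0, c))
        (singularCohomology.map R R (ContinuousMap.fst : C(U × Y, U)) j c') := by
  rw [hY.circleMap_apply R R, hY.circleMap_apply R R, map_zero, zero_add, map_zero, zero_add]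
  exact hY.circleSigma_cupProduct R h c c'

end IsCircleLike

/-- `constClass 1 = 1`. [folklore] -/
theorem constClass_one_eq_one (X : Type u) [TopologicalSpace X] :
    constClass (R := R) R X 1 = singularCohomology.one R X :=
  (relSingularCohomology.π_cocyclesMk_eq_homologyCls (cochainOne R X) (d_cochainOne R) _).symm

/-- `constClass m = m • 1`. [folklore] -/
theorem constClass_eq_smul_one (X : Type u) [TopologicalSpace X] (m : R) :
    constClass (R := R) R X m = m • singularCohomology.one R X := by
  rw [← constClass_one_eq_one, ← constClass_smul, smul_eq_mul, mul_one]

/-! ### The sphere's second summand is linear -/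

namespace IsSphereLike

variable {A₁ A₂ : Set Y} {W₁ W₂ Vp Vm : Set ↥(A₁ ∩ A₂)} (hY : IsSphereLike Y A₁ A₂ W₁ W₂ Vp Vm)
include hY

/-- **`σ(c ⌣ c') = σ(c) ⌣ pr₁^* c'`.** [cite: HatcherAT2002, §3.1 pp. 200–202] -/
theorem sigmaMap_cupProduct {i j n : ℕ} (h : i + j = n) (c : singularCohomology R R U i) (c' : singularCohomology R R U j) :
    hY.sigmaMap R R n (cupProduct h c c') =
      cupProduct (show (i + 2) + j = n + 2 by omega) (hY.sigmaMap R R i c)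
        (singularCohomology.map R R (ContinuousMap.fst : C(U × Y, U)) j c') := by
  rw [hY.sigmaMap_apply R R, hY.sigmaMap_apply R R, hY.circleLike.circleMap_zero_cupProduct R h]
  have hT : transport U R R A₁ A₂ (n + 1)
      (cupProduct (show (i + 1) + j = n + 1 by omega) (hY.circleLike.circleMap R R (U := U) i (0, c))
        (singularCohomology.map R R (ContinuousMap.fst : C(U × ↥(A₁ ∩ A₂), U)) j c')) =
      cupProduct (show (i + 1) + j = n + 1 by omega) (transport U R R A₁ A₂ (i + 1) (hY.circleLike.circleMap R R (U := U) i (0, c)))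
        (singularCohomology.map R R (interIncl U A₁ A₂) j
          (singularCohomology.map R R (ContinuousMap.fst : C(U × Y, U)) j c')) := by
    change singularCohomology.map R R (interHomeomorph U A₁ A₂ : C(↥(inter U A₁ A₂), U × ↥(A₁ ∩ A₂))) (n + 1) _ = _
    rw [cupProduct_map]
    congr 1
    rw [← ModuleCat.comp_apply, ← singularCohomology.map_comp, ← ModuleCat.comp_apply, ← singularCohomology.map_comp]
    rfl
  rw [hT, twoPieceKappa_cupProduct]

/-- **`σ(c) = σ(1) ⌣ pr₁^* c`.** [cite: HatcherAT2002, §3.2 Thm. 3.16] -/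
theorem sigmaMap_eq_sigmaMap_one_cup {j : ℕ} (c : singularCohomology R R U j) :
    hY.sigmaMap R R j c =
      cupProduct (show (0 + 2) + j = j + 2 by omega) (hY.sigmaMap R R 0 (singularCohomology.one R U))
        (singularCohomology.map R R (ContinuousMap.fst : C(U × Y, U)) j c) := by
  rw [← hY.sigmaMap_cupProduct R (Nat.zero_add j), one_cupProduct]

/-- **`σ_U(1) = pr₂^* ω(1)`** (naturality of `σ` along `U → pt`). [cite: HatcherAT2002, §3.1 pp. 200–202] -/
theorem sigmaMap_one_eq_map_snd_omegaFibre :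
    hY.sigmaMap R R (U := U) 0 (singularCohomology.one R U) =
      singularCohomology.map R R (ContinuousMap.snd : C(U × Y, Y)) 2 (hY.omegaFibre R R 1) := by
  have hg : singularCohomology.one R U =
      singularCohomology.map R R (ContinuousMap.const U (PUnit.unit : PUnit.{u + 1})) 0
        (singularCohomology.one R PUnit.{u + 1}) := (singularCohomology.map_one _).symm
  rw [hg, ← hY.map_prodMapId_sigmaMap R R, ← constClass_one_eq_one R, omegaFibre, ← ModuleCat.comp_apply,
    ← singularCohomology.map_comp]
  have hmap : (((Homeomorph.punitProd Y).symm : C(Y, PUnit.{u + 1} × Y)).comp ContinuousMap.snd) =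
      prodMapId (ContinuousMap.const U (PUnit.unit : PUnit.{u + 1})) := ContinuousMap.ext fun _ ↦ rfl
  rw [hmap, omegaProd, hY.sphereMap_apply R R, map_zero]
  exact (congrArg _ (zero_add _)).symm

/-- **The cup-product form of the splitting: `sphereMap (y, c) = pr₁^* y + pr₂^* ω(1) ⌣ pr₁^* c`.**
[cite: HatcherAT2002, §3.2 Thm. 3.16] -/
theorem sphereMap_eq_cup {i : ℕ} (y : singularCohomology R R U (i + 2)) (c : singularCohomology R R U i) :
    hY.sphereMap R R i (y, c) =
      singularCohomology.map R R (ContinuousMap.fst : C(U × Y, U)) (i + 2) y +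
        cupProduct (show 2 + i = i + 2 by omega)
          (singularCohomology.map R R (ContinuousMap.snd : C(U × Y, Y)) 2 (hY.omegaFibre R R 1))
          (singularCohomology.map R R (ContinuousMap.fst : C(U × Y, U)) i c) := by
  rw [hY.sphereMap_apply R R, hY.sigmaMap_eq_sigmaMap_one_cup R, hY.sigmaMap_one_eq_map_snd_omegaFibre R]

/-- **Künneth in cup form for a sphere-like fibre**: `(y, c) ↦ pr₁^* y + pr₂^* ω ⌣ pr₁^* c` is a
bijection `Hⁱ⁺²(U) × Hⁱ(U) → Hⁱ⁺²(U × P)` — `H*(U × P)` is free over `H*(U)` on `1, ω`.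
[cite: HatcherAT2002, §3.2 Thm. 3.16] -/
theorem cupSplit_bijective (i : ℕ) :
    Function.Bijective fun p : singularCohomology R R U (i + 2) × singularCohomology R R U i ↦
      singularCohomology.map R R (ContinuousMap.fst : C(U × Y, U)) (i + 2) p.1 +
        cupProduct (show 2 + i = i + 2 by omega)
          (singularCohomology.map R R (ContinuousMap.snd : C(U × Y, Y)) 2 (hY.omegaFibre R R 1))
          (singularCohomology.map R R (ContinuousMap.fst : C(U × Y, U)) i p.2) := by
  have h : (fun p : singularCohomology R R U (i + 2) × singularCohomology R R U i ↦
      singularCohomology.map R R (ContinuousMap.fst : C(U × Y, U)) (i + 2) p.1 +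
        cupProduct (show 2 + i = i + 2 by omega)
          (singularCohomology.map R R (ContinuousMap.snd : C(U × Y, Y)) 2 (hY.omegaFibre R R 1))
          (singularCohomology.map R R (ContinuousMap.fst : C(U × Y, U)) i p.2)) = hY.sphereMap R R (U := U) i := by
    funext p
    exact (hY.sphereMap_eq_cup R p.1 p.2).symm
  rw [h]
  exact hY.sphereMap_bijective R R i

/-- `ω_U(m) = pr₂^* ω(1) ⌣ pr₁^*(constClass m)`. [folklore] -/
theorem omegaProd_eq_cup (m : R) :
    hY.omegaProd R R U m =
      cupProduct (show 2 + 0 = 0 + 2 by omega)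
        (singularCohomology.map R R (ContinuousMap.snd : C(U × Y, Y)) 2 (hY.omegaFibre R R 1))
        (singularCohomology.map R R (ContinuousMap.fst : C(U × Y, U)) 0 (constClass R U m)) := by
  rw [omegaProd, hY.sphereMap_eq_cup R, map_zero, zero_add]

end IsSphereLike

end Literature.AlgebraicTopology.SingularHomology
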